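import Literature.AlgebraicGeometry.Resolution.Lipman1969RationalSurfaceSingularities
import Literature.AlgebraicGeometry.Resolution.AffineBlowup
import HarnessLib

/-!
# Quadratic transforms of rational surface singularities are normal (Lipman 1969, Proposition (8.1))

Topic: `Literature/AlgebraicGeometry/Resolution`.  NAMED FACT (D-0014), typed from the printed page of J. Lipman,
*Rational singularities, with applications to algebraic surfaces and unique factorization*, Publ. Math. IHÉS 36 (1969)
195–279 (doi:10.1007/BF02684604; held copy `paper:doi-10-1007-bf02684604`, read on the page: PDF p. 11 = printed p. 204,
where the statement is announced and used, and PDF p. 19 = p. 212, Proposition (8.1)), in the vocabulary of this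
directory (`HasRationalSingularity` of `Resolution/Lipman1969RationalSurfaceSingularities`; the quadratic transform
`Bl_𝔪(Spec R) = Proj(⊕ₙ 𝔪ⁿ)` as `affineBlowup (maximalIdeal R)` of `Resolution/AffineBlowup`).

## The source (quoted from the printed paper)

Proof of Theorem (4.1), p. 204: "We shall assume the following result, to be proved later (Proposition (8.1)).  *If `Y`
is a normal surface having only rational singularities, and if `h : Y′ → Y` is a quadratic transformation, then `Y′` is a
normal surface.*"  §8, p. 212, Proposition (8.1), proved from Theorem (7.1) (p. 209: in a two-dimensional normal local
ring with a rational singularity the product of complete ideals is complete, so every power `𝔪ⁿ` of the maximal ideal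
is complete) and §§5–6 (complete ideals and projective normalization: `Proj` of the normal graded ring `⊕ₙ 𝔪ⁿ` is
normal).

## What is vendored, and in which vocabulary

The LOCAL form, which is the one used in the proof of Theorem (4.1) (the quadratic transformation of the surface `Y` at a
closed point `y` is, over `Spec 𝒪_{Y,y}`, the blowing up of the maximal ideal of the two-dimensional normal local ring
`R = 𝒪_{Y,y}`, which has a rational singularity): for `R` a two-dimensional normal Noetherian local domain with a
rational singularity (`HasRationalSingularity R`, Definition (1.1)), every local ring of the quadratic transform
`affineBlowup (maximalIdeal R)` is an integrally closed domain.

* `Lipman1969_8_1` — the named fact.  Users take `(h : Lipman1969_8_1)`.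

VACUITY: not decided by unfolding; the hypothesis block is satisfiable (`R` regular of dimension `2`: then
`Bl_𝔪(Spec R)` is regular, hence normal).  Consumer: the crux chain W4.4 (`HomologicalConductor.NoZenoR`) of the
summit `ResolutionOfSingularities`, where it yields Lipman's Theorem (4.1) (`Lipman1969_4_1`) by Lipman's own proof
(`Summits/…/Theorems/HomologicalConductorNoZenoRLipman41Of81`); nothing here depends on that summit.

## What is NOT here

The proof (complete ideals, Theorem (7.1), Proposition (6.2)); the global statement for a normal surface `Y` with only
rational singularities (it follows from the local one off the blown-up point); Lipman's further results of §8
(the quadratic transform has only rational singularities, (8.1) with (1.2)).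
`-- TODO(general form):` Proposition (8.1) for every normal surface `Y` having only rational singularities and every
quadratic transformation `h : Y′ → Y`.

## References

* J. Lipman, *Rational singularities, with applications to algebraic surfaces and unique factorization*, Publ. Math.
  IHÉS 36 (1969) 195–279: Proposition (8.1) (p. 212), Theorem (7.1) (p. 209), Theorem (4.1) and its proof (p. 204).
  [Lipman1969]
-/

noncomputable section

open CategoryTheory AlgebraicGeometry TopologicalSpace IsLocalRing

universe u

namespace Literature.AlgebraicGeometry.Resolution

/-- NAMED FACT — **Lipman 1969, Proposition (8.1)** ("If `Y` is a normal surface having only rational singularities, and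
if `h : Y′ → Y` is a quadratic transformation, then `Y′` is a normal surface"), LOCAL form: for `R` a two-dimensional
normal Noetherian local domain with a rational singularity (`HasRationalSingularity R`), every local ring of the
quadratic transform `Bl_𝔪(Spec R) = affineBlowup (maximalIdeal R)` is an integrally closed domain.  Users take
`(h : Lipman1969_8_1)`. [cite: Lipman1969, Proposition (8.1) (p. 212)] -/
def Lipman1969_8_1 : Prop :=
  ∀ (R : Type u) [CommRing R] [IsNoetherianRing R] [IsLocalRing R] [IsDomain R] [IsIntegrallyClosed R],
    ringKrullDim R = 2 → HasRationalSingularity R →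
    ∀ y : affineBlowup (maximalIdeal R), IsIntegrallyClosed ((affineBlowup (maximalIdeal R)).presheaf.stalk y)
-- TODO(general form): Lipman states (8.1) for every normal surface `Y` having only rational singularities and every
-- quadratic transformation `h : Y′ → Y` (blowing up of a closed point): `Y′` is a normal surface.

end Literature.AlgebraicGeometry.Resolution

/-! ## Theorem (7.1): products of complete ideals are complete (appended, hand leafhand-res-homologicalconduct-22 g0)

The printed proof of Proposition (8.1) reads (p. 212): «The first assertion follows from Theorem (7.1) and Lemma (5.2).»
Lemma (5.2) (p. 206: «Let `X` be an integral scheme and let `𝒥 ≠ 0` be a quasi-coherent `𝒪_X`-submodule of `𝒦`.  If all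
the positive powers of `𝒥` are complete, then the scheme obtained by blowing up `𝒥` is normal») is PROVED, in its affine
normal form, in `Summits/ResolutionOfSingularities/ResolutionOfSingularities/Theorems/HomologicalConductorNoZenoRBlowupNormalOfCompletePowers`
(`affineBlowup.isIntegrallyClosed_stalk_of_forall_pow`).  The other input is vendored here as a NAMED FACT:

**Theorem (7.1)** (p. 209). «Let `Y` be a normal irreducible surface having only rational singularities.  Then any product
of complete coherent `𝒪_Y`-ideals is again complete.»  Its proof (pp. 210–211) reduces at once to the LOCAL case (p. 210:
«it is enough to treat the case `Y = Spec(S)`, `S` being a two-dimensional normal local domain with a rational singularity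
(cf. remark d) following Definition (5.1)).  Let `𝒥`, `𝒦` be coherent complete `𝒪_Y`-ideals; it will be sufficient to show
that `𝒥𝒦` is complete») and then uses Theorem (7.2) (products of contracted ideals are contracted, via the cohomological
Lemma (7.3)), Proposition (6.2) (complete = contracted for every proper birational map, `Y` normal) and Proposition (1.2) B)
(a desingularization dominating the blowing up of the completion of `𝒥𝒦`).

«Complete» (Definition (5.1): the completion of `𝒥` is the degree-one piece of the integral closure of `⊕ 𝒥ⁿ` in `⊕ 𝒦ⁿ`)
means, for an ideal `I` of a NORMAL domain `R`, that `I` is integrally closed in the sense of Huneke–Swanson, Def. 1.1.1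
(p. 206: «when `X` is normal, `⊕ 𝒦ⁿ` is integrally closed, so that if `𝒥` is an `𝒪_X`-ideal then so is `𝒥̄ₙ` for each
`n`»): every `r ∈ R` with an equation of integral dependence `r^k + ∑_{j=1}^{k} c_j r^{k-j} = 0`, `c_j ∈ I^j`, lies in `I`
— the format of `Literature/RingTheory/IntegralClosure/IntegralOverIdealRees` (no definition of `Ī` exists in the tree, so
the condition is spelled out).

* `Lipman1969_7_1` — the named fact, LOCAL form.  Users take `(h : Lipman1969_7_1)`.

VACUITY: not decided by unfolding; the hypothesis block is satisfiable (`R` regular local of dimension `2` has a rational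
singularity, and there the statement is Zariski's product theorem, Huneke–Swanson Thm. 14.4.4).  Consumer: the crux chain
W4.4 (`HomologicalConductor.NoZenoR`) of the summit `ResolutionOfSingularities`, where together with Lemma (5.2) it
discharges `Lipman1969_8_1` (`…Theorems.HomologicalConductorNoZenoRLipman81Of71`); nothing here depends on that summit.
`-- TODO(general form):` Theorem (7.1) for every normal irreducible surface `Y` having only rational singularities and all
products of complete coherent `𝒪_Y`-ideals (the global statement follows from the local one stalkwise, completeness being
local: remark d) after Definition (5.1)).
-/

namespace Literature.AlgebraicGeometry.Resolution

/-- NAMED FACT — **Lipman 1969, Theorem (7.1)** («Let `Y` be a normal irreducible surface having only rational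
singularities.  Then any product of complete coherent `𝒪_Y`-ideals is again complete»), LOCAL form (p. 210: «it is enough
to treat the case `Y = Spec(S)`, `S` being a two-dimensional normal local domain with a rational singularity … Let `𝒥`, `𝒦`
be coherent complete `𝒪_Y`-ideals; it will be sufficient to show that `𝒥𝒦` is complete»): for `R` a two-dimensional
normal Noetherian local domain with a rational singularity (`HasRationalSingularity R`) and ideals `I`, `J` of `R` which are
complete — i.e. integrally closed: every `r` with an equation of integral dependence `r^k + ∑_{j=1}^{k} c_j r^{k-j} = 0`,
`c_j ∈ I^j` (Huneke–Swanson Def. 1.1.1), lies in `I` — the product `I * J` is complete.  Users take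
`(h : Lipman1969_7_1)`. [cite: Lipman1969, Theorem (7.1) (p. 209), proof p. 210] -/
def Lipman1969_7_1 : Prop :=
  ∀ (R : Type u) [CommRing R] [IsNoetherianRing R] [IsLocalRing R] [IsDomain R] [IsIntegrallyClosed R],
    ringKrullDim R = 2 → HasRationalSingularity R →
    ∀ I J : Ideal R,
      (∀ r : R, (∃ (k : ℕ) (c : ℕ → R), (∀ j ∈ Finset.Icc 1 k, c j ∈ I ^ j) ∧
        r ^ k + ∑ j ∈ Finset.Icc 1 k, c j * r ^ (k - j) = 0) → r ∈ I) →
      (∀ r : R, (∃ (k : ℕ) (c : ℕ → R), (∀ j ∈ Finset.Icc 1 k, c j ∈ J ^ j) ∧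
        r ^ k + ∑ j ∈ Finset.Icc 1 k, c j * r ^ (k - j) = 0) → r ∈ J) →
      ∀ r : R, (∃ (k : ℕ) (c : ℕ → R), (∀ j ∈ Finset.Icc 1 k, c j ∈ (I * J) ^ j) ∧
        r ^ k + ∑ j ∈ Finset.Icc 1 k, c j * r ^ (k - j) = 0) → r ∈ I * J
-- TODO(general form): Lipman states (7.1) for every normal irreducible surface `Y` having only rational singularities:
-- any product of complete coherent `𝒪_Y`-ideals is complete (Definition (5.1), `𝒪_Y`-submodules of `𝒦`).

end Literature.AlgebraicGeometry.Resolution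

/-! ## Theorem (7.2): products of contracted ideals are contracted — the case of a desingularization of a rational
surface singularity (appended, hand leafhand-res-homologicalconduct-22 g0)

A second road to Proposition (8.1) which avoids Theorem (7.1) (and with it Proposition (6.2) and Proposition (1.2) B)):
for a NON-REGULAR `R` the powers `𝔪ⁿ` are complete as soon as they are CONTRACTED for one desingularization
`π : X → Spec R` — `\overline{𝔪ⁿ} ⊆ Γ(X, 𝔪ⁿ𝒪_X) ∩ R` because `𝔪𝒪_X` is invertible (Proposition (3.1)) and `X` is
normal; PROVED in `Summits/…/Theorems/HomologicalConductorNoZenoRPowersContracted` — and contractedness of the powers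
is Theorem (7.2) applied to `I = 𝔪`, `J = 𝔪ᵏ`:

**Theorem (7.2)** (p. 209). «Let `Y` be an integral noetherian scheme, let `X` be a normal surface, and let `f : X → Y` be
a proper map with `f_*(𝒪_X) = 𝒪_Y`, `R¹f_*(𝒪_X) = 0`.  Then any product of coherent contracted (for `f`) `𝒪_Y`-ideals is
again contracted.»  (Definition (6.1) and p. 208: «`𝒥` is contracted for `f` if and only if `𝒥 = f_*(𝒥𝒪_X)`»; proof
pp. 210–211 through the cohomological Lemma (7.3): `Γ(𝒥𝒪_X) ⊗ Γ(𝒦𝒪_X) → Γ(𝒥𝒦𝒪_X)` is onto when `H¹` of the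
syzygy sheaves vanishes.)

Vendored here in the case `Y = Spec R`, `R` a two-dimensional normal Noetherian local domain with a rational singularity,
`f = π` a desingularization (`IsResolution π`: proper, birational, `X` regular — so `X` is a normal surface,
`f_*𝒪_X = 𝒪_Y` since `R` is normal, and `R¹f_*𝒪_X = 0`, i.e. `H¹(X, 𝒪_X) = 0`, by Proposition (1.2) 2)).  «`I` is
contracted for `π`» is spelled STALKWISE through the structure maps `R → Γ(X, 𝒪_X) → 𝒪_{X,x}`
(`Literature.AlgebraicGeometry.Morphisms.algebraMapΓ`, Mathlib `germ`): every `r ∈ R` whose germ lies in `I·𝒪_{X,x}` for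
every `x ∈ X` lies in `I` (for the ideal sheaf `I𝒪_X ⊆ 𝒪_X` one has `(I𝒪_X)_x = I·𝒪_{X,x}` and a global function lies
in `Γ(X, I𝒪_X)` iff all its germs lie in the stalks, so this is `I = Γ(X, I𝒪_X) ∩ R = f_*(I𝒪_X)(Y)`).

* `Lipman1969_7_2` — the named fact (desingularization form).  Users take `(h : Lipman1969_7_2)`.

VACUITY: not decided by unfolding; the hypothesis block is satisfiable (e.g. `R` regular, `π` the blowing up of the
closed point; or any rational double point with its minimal resolution).  Consumer: the crux chain W4.4
(`HomologicalConductor.NoZenoR`): `Lipman1969_8_1` for non-regular `R` ⟸ `Lipman1969_7_2`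
(`…Theorems.HomologicalConductorNoZenoRLipman81Of72`); nothing here depends on that summit.
`-- TODO(general form):` Theorem (7.2) for every proper `f : X → Y` from a normal surface to an integral noetherian
scheme with `f_*𝒪_X = 𝒪_Y` and `R¹f_*𝒪_X = 0`, and all pairs of coherent contracted `𝒪_Y`-ideals.
-/

namespace Literature.AlgebraicGeometry.Resolution

/-- NAMED FACT — **Lipman 1969, Theorem (7.2)** («Let `Y` be an integral noetherian scheme, let `X` be a normal surface,
and let `f : X → Y` be a proper map with `f_*(𝒪_X) = 𝒪_Y`, `R¹f_*(𝒪_X) = 0`.  Then any product of coherent contracted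
(for `f`) `𝒪_Y`-ideals is again contracted»), in the case `Y = Spec R` for `R` a two-dimensional normal Noetherian local
domain with a rational singularity and `f = π : X → Spec R` a desingularization: if the ideals `I`, `J` of `R` are
contracted for `π` (stalkwise: `r ∈ I·𝒪_{X,x}` for all `x` implies `r ∈ I`), then so is `I * J`.  Users take
`(h : Lipman1969_7_2)`. [cite: Lipman1969, Theorem (7.2) (p. 209), Definition (6.1) (p. 207–208)] -/
def Lipman1969_7_2 : Prop :=
  ∀ (R : Type u) [CommRing R] [IsNoetherianRing R] [IsLocalRing R] [IsDomain R] [IsIntegrallyClosed R],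
    ringKrullDim R = 2 → HasRationalSingularity R →
    ∀ (X : Scheme.{u}) (π : X ⟶ Spec (.of R)), IsResolution π →
    ∀ I J : Ideal R,
      (∀ r : R, (∀ x : X, (X.presheaf.germ ⊤ x trivial).hom (Morphisms.algebraMapΓ π r) ∈
        I.map ((X.presheaf.germ ⊤ x trivial).hom.comp (Morphisms.algebraMapΓ π))) → r ∈ I) →
      (∀ r : R, (∀ x : X, (X.presheaf.germ ⊤ x trivial).hom (Morphisms.algebraMapΓ π r) ∈
        J.map ((X.presheaf.germ ⊤ x trivial).hom.comp (Morphisms.algebraMapΓ π))) → r ∈ J) →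
      ∀ r : R, (∀ x : X, (X.presheaf.germ ⊤ x trivial).hom (Morphisms.algebraMapΓ π r) ∈
        (I * J).map ((X.presheaf.germ ⊤ x trivial).hom.comp (Morphisms.algebraMapΓ π))) → r ∈ I * J
-- TODO(general form): Theorem (7.2) for every proper `f : X → Y`, `Y` integral noetherian, `X` a normal surface,
-- `f_*𝒪_X = 𝒪_Y`, `R¹f_*𝒪_X = 0`, and all pairs of coherent contracted `𝒪_Y`-ideals.

end Literature.AlgebraicGeometry.Resolution

end
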